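import Mathlib
import Summits.RiemannHypothesis.RiemannHypothesis.Theorems.WeilFarFloorResidualEnergyCramer
import Summits.RiemannHypothesis.RiemannHypothesis.Theorems.WeilFarFloorCramerFunction
import Literature.NumberTheory.LFunctions.CramerMeanSquareAsymptoticRH
import HarnessLib

/-!
# The gap coefficient `J(b)` is at most `(4β₂ + ε)·b` under RH (`β₂ = Σ_ρ m(ρ)²/|ρ|²`)

Helper file (`--supports stmt-RiemannHypothesis-0098`, lead-track anchor: Weil-positivity window ladder, format-C far bound),
pure proofs.  Seat rh-explicit-weil-1 gen16 (memo `run/shared/lean/pub/rh-explicit/rh-explicit-weil-1/FORMAT-K3.md` §17).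

Inputs: `WeilFarFloorResidualEnergyCramer` (`|√J(b) − ½√(e^b/P)√Φ(b)| ≤ C`, `Φ(b) = ∫₀^{2b}(g(u) + g(2b−u))²`,
`g(u) = e^{−u/2}(ψ(e^u) − e^u)` the Cramér function) and Literature `CramerMeanSquare.tendsto_mean_sq_psi_exp_sub_of_RH`
(MV Thm. 13.6: `(1/U)∫₀^U g² → β₂ = Σ_ρ m(ρ)²/|ρ|²`).
With `Φ(b) ≤ 4F(2b)` and `e^b ≤ 2P` (`WeilFarFloorCramerFunction`):
* ★ `residualEnergy_le_linear_of_RH`: **`RH → ∀ ε > 0, ∃ b₀, ∀ b ≥ b₀, J(b) ≤ (4β₂ + ε)·b`** — the constant of the linear bound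
  `J ≤ K(b+1)` identified (`= 4β_F`, `β_F = 2 + γ − log 4π` if the zeros are simple); with the second-order law
  (`WeilFarFloorSecondOrderLawRH`) `λ_max(a) − R_c(a) ≤ (4β₂ + ε)·a·e^{−a}` eventually.
Standard axioms only; RH enters as Mathlib's `RiemannHypothesis`.  Nothing here bears on the truth of RH.
-/

set_option linter.dupNamespace false
set_option autoImplicit false

noncomputable section

open MeasureTheory Set Filter Topology
open scoped Real BigOperators ArithmeticFunction.vonMangoldt Chebyshev

namespace Summit.RiemannHypothesis.RiemannHypothesis.Theorems.WeilFormatC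

namespace FloorResidualMean

open Literature.NumberTheory.LFunctions FloorCosh FloorCoshSplit

variable {b : ℝ}

/-! ## The gap coefficient is at most `(4β₂ + ε)·b` -/

/-- **`RH → ∀ ε > 0, ∃ b₀, ∀ b ≥ b₀, J(b) ≤ (4β₂ + ε)·b`**, `β₂ = Σ_ρ m(ρ)²/|ρ|²` (`= β_F = 2 + γ − log 4π` if all zeros are simple):
the residual energy of the cosh profile — the coefficient of the floor gap — grows at most linearly with the explicit slope `4β₂`
(sharp as a limsup if the ordinates are linearly independent). -/
theorem residualEnergy_le_linear_of_RH (hRH : RiemannHypothesis) {ε : ℝ} (hε : 0 < ε) :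
    ∃ b₀ : ℝ, ∀ b : ℝ, b₀ ≤ b →
      (∫ x in Ioo (-b) b,
          ((∑ n ∈ weilPrimeIndex b, (Λ n : ℝ) / Real.sqrt n *
              ((Icc (-b) b).indicator (fun y ↦ Real.cosh (y / 2)) (x - Real.log n)
                + (Icc (-b) b).indicator (fun y ↦ Real.cosh (y / 2)) (x + Real.log n)))
            - primeShiftForm b ((Icc (-b) b).indicator (fun y ↦ Real.cosh (y / 2))) / (b + Real.sinh b)
              * (Icc (-b) b).indicator (fun y ↦ Real.cosh (y / 2)) x) ^ 2) / (b + Real.sinh b)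
        ≤ (4 * (∑' ρ : ZetaZeros.riemannZetaNontrivialZeros,
            (riemannZetaZeroOrder (ρ : ℂ) : ℝ) * ((riemannZetaZeroOrder (ρ : ℂ) : ℝ) / ‖(ρ : ℂ)‖ ^ 2)) + ε) * b := by
  set β := ∑' ρ : ZetaZeros.riemannZetaNontrivialZeros,
    (riemannZetaZeroOrder (ρ : ℂ) : ℝ) * ((riemannZetaZeroOrder (ρ : ℂ) : ℝ) / ‖(ρ : ℂ)‖ ^ 2) with hβdef
  have hβ0 : 0 ≤ β := tsum_nonneg fun ρ ↦ by
    have := riemannZetaZeroOrder_nonneg (ZetaZeros.riemannZetaNontrivialZeros.ne_one ρ.2)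
    have hm : (0 : ℝ) ≤ riemannZetaZeroOrder (ρ : ℂ) := by exact_mod_cast this
    positivity
  obtain ⟨C, b₁, hα⟩ := abs_sqrt_residualEnergy_sub_le_of_RH hRH
  -- the mean square: F(U) ≤ (β + δ)U for U ≥ U₀, δ = ε/8
  set δ := ε / 8 with hδ
  have hδ0 : 0 < δ := by positivity
  have hF := CramerMeanSquare.tendsto_mean_sq_psi_exp_sub_of_RH hRH
  obtain ⟨U₀, hU₀⟩ := eventually_atTop.1 ((Metric.tendsto_nhds.1 hF) δ hδ0)
  -- constants
  have hC0 : 0 ≤ C := le_trans (abs_nonneg _) (hα b₁ le_rfl)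
  set K := β + δ with hK
  have hK0 : 0 < K := by positivity
  set D := 32 * C ^ 2 * K / ε + C ^ 2 with hD
  have hD0 : 0 ≤ D := by positivity
  refine ⟨max (max b₁ 1) (max (U₀ / 2) (3 * D / ε + 1)), fun b hb ↦ ?_⟩
  have hbb₁ : b₁ ≤ b := le_trans (le_max_left _ _) (le_trans (le_max_left _ _) hb)
  have hb1 : 1 ≤ b := le_trans (le_max_right _ _) (le_trans (le_max_left _ _) hb)
  have hbU : U₀ ≤ 2 * b := by
    have := le_trans (le_max_left _ _) (le_trans (le_max_right _ _) hb); linarith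
  have hbD : 3 * D / ε ≤ b := by
    have := le_trans (le_max_right _ _) (le_trans (le_max_right _ _) hb); linarith
  have hb0 : 0 ≤ b := by linarith
  set P := b + Real.sinh b with hP
  have hP0 : 0 < P := by have := Real.sinh_nonneg_iff.2 hb0; rw [hP]; linarith
  set J := (∫ x in Ioo (-b) b,
      ((∑ n ∈ weilPrimeIndex b, (Λ n : ℝ) / Real.sqrt n *
          ((Icc (-b) b).indicator (fun y ↦ Real.cosh (y / 2)) (x - Real.log n)
            + (Icc (-b) b).indicator (fun y ↦ Real.cosh (y / 2)) (x + Real.log n)))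
        - primeShiftForm b ((Icc (-b) b).indicator (fun y ↦ Real.cosh (y / 2))) / P
          * (Icc (-b) b).indicator (fun y ↦ Real.cosh (y / 2)) x) ^ 2) / P with hJ
  set Φ := ∫ u in (0 : ℝ)..(2 * b), (Real.exp (-(u / 2)) * (ψ (Real.exp u) - Real.exp u)
      + Real.exp (-((2 * b - u) / 2)) * (ψ (Real.exp (2 * b - u)) - Real.exp (2 * b - u))) ^ 2 with hΦ
  set F := ∫ u in (0 : ℝ)..(2 * b), Real.exp (-u) * (ψ (Real.exp u) - Real.exp u) ^ 2 with hFdef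
  have hJ0 : 0 ≤ J := div_nonneg (integral_nonneg fun x ↦ sq_nonneg _) hP0.le
  -- F ≤ K·2b
  have hFle : F ≤ K * (2 * b) := by
    have h := hU₀ (2 * b) hbU
    rw [Real.dist_eq] at h
    have h2b : 0 < 2 * b := by linarith
    have h1 : 1 / (2 * b) * F ≤ β + δ := by linarith [(abs_lt.1 h).2]
    have h3 := mul_le_mul_of_nonneg_left h1 h2b.le
    rw [← mul_assoc, mul_one_div_cancel h2b.ne', one_mul] at h3
    linarith
  -- Φ ≤ 4F and the main term m² ≤ 4Kb
  have hΦle : Φ ≤ 4 * F := cramerLagEnergy_le hb0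
  have hΦ0 : 0 ≤ Φ := intervalIntegral.integral_nonneg (by linarith) fun u _ ↦ sq_nonneg _
  have hexpP : Real.exp b / P ≤ 2 := by
    rw [div_le_iff₀ hP0]; exact exp_le_two_mul_norm (by linarith)
  set m := 1 / 2 * Real.sqrt (Real.exp b / P) * Real.sqrt Φ with hm
  have hm0 : 0 ≤ m := by positivity
  have hm2 : m ^ 2 ≤ 4 * K * b := by
    have e : m ^ 2 = 1 / 4 * (Real.exp b / P) * Φ := by
      rw [hm, mul_pow, mul_pow, Real.sq_sqrt (by positivity), Real.sq_sqrt hΦ0]; ring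
    rw [e]
    have hΦ8 : Φ ≤ 8 * K * b := by linarith
    have h2 : Real.exp b / P * Φ ≤ 2 * (8 * K * b) := mul_le_mul hexpP hΦ8 hΦ0 (by norm_num)
    linarith
  -- √J ≤ m + C
  have hsqJ : Real.sqrt J ≤ m + C := by
    have h := hα b hbb₁
    have := (abs_le.1 h).2
    linarith
  have hJle : J ≤ (m + C) ^ 2 := by
    calc J = Real.sqrt J ^ 2 := (Real.sq_sqrt hJ0).symm
      _ ≤ (m + C) ^ 2 := pow_le_pow_left₀ (Real.sqrt_nonneg _) hsqJ 2
  -- (m + C)² = m² + 2mC + C² ≤ 4Kb + (ε/8)b + 32C²K/ε + C²  (2mC ≤ (ε/8)b + 8m²C²/(εb) … via AM–GM on 2·(m)·(C))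
  have hamgm : 2 * m * C ≤ ε / 8 * b + 32 * C ^ 2 * K / ε := by
    -- AM–GM: 2mC ≤ t·m² + C²/t with t = ε/(32K), and m² ≤ 4Kb
    have ht : 0 < ε / (32 * K) := by positivity
    have h1 : 2 * m * C * (ε / (32 * K)) ≤ (ε / (32 * K)) ^ 2 * m ^ 2 + C ^ 2 := by
      nlinarith [sq_nonneg (ε / (32 * K) * m - C)]
    have h2 : 2 * m * C ≤ ((ε / (32 * K)) ^ 2 * m ^ 2 + C ^ 2) / (ε / (32 * K)) := (le_div_iff₀ ht).2 h1
    have h3 : ((ε / (32 * K)) ^ 2 * m ^ 2 + C ^ 2) / (ε / (32 * K)) = ε / (32 * K) * m ^ 2 + C ^ 2 / (ε / (32 * K)) := by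
      field_simp
    have h4 : ε / (32 * K) * m ^ 2 ≤ ε / 8 * b := by
      calc ε / (32 * K) * m ^ 2 ≤ ε / (32 * K) * (4 * K * b) := mul_le_mul_of_nonneg_left hm2 ht.le
        _ = ε / 8 * b := by field_simp; ring
    have h5 : C ^ 2 / (ε / (32 * K)) = 32 * C ^ 2 * K / ε := by
      field_simp
    linarith
  have hfin : (m + C) ^ 2 ≤ (4 * β + ε) * b := by
    have e1 : (m + C) ^ 2 = m ^ 2 + 2 * m * C + C ^ 2 := by ring
    rw [e1]
    have hrem : ε / 8 * b + 32 * C ^ 2 * K / ε + C ^ 2 ≤ ε / 2 * b := by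
      have h3D : 3 * D ≤ b * ε := (div_le_iff₀ hε).1 hbD
      have hD' : D = 32 * C ^ 2 * K / ε + C ^ 2 := rfl
      have hεb : 0 ≤ ε * b := mul_nonneg hε.le hb0
      linarith
    have hKb : 4 * K * b = (4 * β + ε / 2) * b := by
      have : K = β + ε / 8 := rfl
      rw [this]; ring
    linarith [hm2, hamgm, hrem, hKb]
  exact hJle.trans hfin

end FloorResidualMean

end Summit.RiemannHypothesis.RiemannHypothesis.Theorems.WeilFormatC
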